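import Literature.NumberTheory.Transcendental.KZDilationBakerSectorComplexPrep
import HarnessLib

/-!
# The Liouville sector of the dilation pencil, II: Nash loops (preparations)

Calculus of a complex-valued one-variable function `w = u + iv` (`u, v : ℝ → ℝ`) staying in the slit
plane (`0 < u ∨ v ≠ 0`): non-vanishing, the derivative of `Log ∘ w` (`HasDerivAt.clog_real`), the
logarithmic derivative `w'/w = ((u'u + v'v) + i(v'u − u'v))/(u² + v²)` and its real and imaginary
parts, the derivative of `arg ∘ w`, the modulus square `u² + v²` (positivity, derivative, Nash-ness).
These are the loop versions of the affine facts of `KZDilationBakerSectorComplexPrep.lean`, used by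
the Liouville (log-exact Nash) sector of the dilation lifting problem at `1` (route
`KontsevichZagierPeriods/LiftingCriteria`, crux `DilationLiftAtOne`).

Everything is proved; no `def`, no named fact.

## References
* standard complex calculus. [folklore]
-/

noncomputable section

open Set Complex
open scoped BigOperators Real Topology ComplexConjugate
open Literature.ModelTheory.ExponentialFields

namespace Literature.NumberTheory.Transcendental

namespace KZ.LiouvilleSector

/-! ### Pointwise facts for `w = u + iv` in the slit plane -/

/-- `u + iv ≠ 0` on the slit condition. [folklore] -/
theorem loop_ne_zero {u v : ℝ} (h : 0 < u ∨ v ≠ 0) : (u : ℂ) + (v : ℂ) * I ≠ 0 := by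
  intro h0
  have hre := congrArg Complex.re h0
  have him := congrArg Complex.im h0
  simp at hre him
  rcases h with h | h
  · linarith
  · exact h him

/-- `u + iv ∈ slitPlane` on the slit condition. [folklore] -/
theorem loop_mem_slitPlane {u v : ℝ} (h : 0 < u ∨ v ≠ 0) : (u : ℂ) + (v : ℂ) * I ∈ slitPlane := by
  rw [Complex.mem_slitPlane_iff]
  simpa using h

/-- `|u + iv|² = u² + v²`. [folklore] -/
theorem normSq_loop (u v : ℝ) : Complex.normSq ((u : ℂ) + (v : ℂ) * I) = u ^ 2 + v ^ 2 := by
  rw [Complex.normSq_apply]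
  simp
  ring

/-- `‖u + iv‖ = √(u² + v²)`. [folklore] -/
theorem norm_loop (u v : ℝ) : ‖(u : ℂ) + (v : ℂ) * I‖ = Real.sqrt (u ^ 2 + v ^ 2) := by
  rw [Complex.norm_eq_sqrt_sq_add_sq]
  simp

/-- `0 < u² + v²` on the slit condition. [folklore] -/
theorem modSq_pos {u v : ℝ} (h : 0 < u ∨ v ≠ 0) : 0 < u ^ 2 + v ^ 2 := by
  rcases h with h | h
  · positivity
  · positivity

/-- **The logarithmic derivative in real form.**
`(u' + iv')/(u + iv) = ((u'u + v'v) + i(v'u − u'v))/(u² + v²)`. [folklore] -/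
theorem logDeriv_eq {u v : ℝ} (u' v' : ℝ) (h : 0 < u ∨ v ≠ 0) :
    ((u' : ℂ) + (v' : ℂ) * I) / ((u : ℂ) + (v : ℂ) * I) =
      (((u' * u + v' * v) / (u ^ 2 + v ^ 2) : ℝ) : ℂ) +
        (((v' * u - u' * v) / (u ^ 2 + v ^ 2) : ℝ) : ℂ) * I := by
  have hw := loop_ne_zero h
  have hm := (modSq_pos h).ne'
  rw [div_eq_iff hw]
  set A : ℝ := (u' * u + v' * v) / (u ^ 2 + v ^ 2) with hA
  set B : ℝ := (v' * u - u' * v) / (u ^ 2 + v ^ 2) with hB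
  apply Complex.ext
  · simp only [Complex.add_re, Complex.mul_re, Complex.mul_im, Complex.ofReal_re, Complex.ofReal_im,
      Complex.I_re, Complex.I_im, mul_zero, mul_one, sub_zero, add_zero, Complex.add_im]
    rw [hA, hB]
    field_simp
    ring
  · simp only [Complex.add_re, Complex.add_im, Complex.mul_re, Complex.mul_im, Complex.ofReal_re,
      Complex.ofReal_im, Complex.I_re, Complex.I_im, mul_zero, mul_one, sub_zero,
      add_zero, zero_add]
    rw [hA, hB]
    field_simp
    ring

/-- Real part of the logarithmic derivative. [folklore] -/
theorem re_logDeriv {u v : ℝ} (u' v' : ℝ) (h : 0 < u ∨ v ≠ 0) :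
    (((u' : ℂ) + (v' : ℂ) * I) / ((u : ℂ) + (v : ℂ) * I)).re = (u' * u + v' * v) / (u ^ 2 + v ^ 2) := by
  rw [logDeriv_eq u' v' h]
  simp only [Complex.add_re, Complex.mul_re, Complex.ofReal_re, Complex.ofReal_im, Complex.I_re,
    Complex.I_im, mul_zero, mul_one, add_zero, sub_self]

/-- Imaginary part of the logarithmic derivative. [folklore] -/
theorem im_logDeriv {u v : ℝ} (u' v' : ℝ) (h : 0 < u ∨ v ≠ 0) :
    (((u' : ℂ) + (v' : ℂ) * I) / ((u : ℂ) + (v : ℂ) * I)).im = (v' * u - u' * v) / (u ^ 2 + v ^ 2) := by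
  rw [logDeriv_eq u' v' h]
  simp only [Complex.add_im, Complex.mul_im, Complex.ofReal_re, Complex.ofReal_im, Complex.I_re,
    Complex.I_im, mul_zero, mul_one, zero_add, add_zero]

/-- **Real part of `c · w'/w`** for `c = γ + iδ`: `γ·Re(w'/w) − δ·Im(w'/w)`. [folklore] -/
theorem re_c_mul_logDeriv (γ δ : ℝ) {u v : ℝ} (u' v' : ℝ) (h : 0 < u ∨ v ≠ 0) :
    (((γ : ℂ) + (δ : ℂ) * I) * (((u' : ℂ) + (v' : ℂ) * I) / ((u : ℂ) + (v : ℂ) * I))).re =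
      γ * ((u' * u + v' * v) / (u ^ 2 + v ^ 2)) - δ * ((v' * u - u' * v) / (u ^ 2 + v ^ 2)) := by
  rw [logDeriv_eq u' v' h]
  simp only [Complex.add_re, Complex.add_im, Complex.mul_re, Complex.mul_im, Complex.ofReal_re,
    Complex.ofReal_im, Complex.I_re, Complex.I_im, mul_zero, mul_one, sub_zero,
    add_zero, zero_add]

/-! ### Derivatives along a loop -/

/-- The complex-valued path `w = u + iv` has derivative `u' + iv'`. [folklore] -/
theorem hasDerivAt_loop {u v : ℝ → ℝ} {u' v' x : ℝ} (hu : HasDerivAt u u' x) (hv : HasDerivAt v v' x) :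
    HasDerivAt (fun y => (u y : ℂ) + (v y : ℂ) * I) ((u' : ℂ) + (v' : ℂ) * I) x :=
  hu.ofReal_comp.add (hv.ofReal_comp.mul_const I)

/-- **Derivative of `Log ∘ w`** in the slit plane: `w'/w`. [folklore] -/
theorem hasDerivAt_log_loop {u v : ℝ → ℝ} {u' v' x : ℝ} (hu : HasDerivAt u u' x)
    (hv : HasDerivAt v v' x) (h : 0 < u x ∨ v x ≠ 0) :
    HasDerivAt (fun y => Complex.log ((u y : ℂ) + (v y : ℂ) * I))
      (((u' : ℂ) + (v' : ℂ) * I) / ((u x : ℂ) + (v x : ℂ) * I)) x :=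
  (hasDerivAt_loop hu hv).clog_real (loop_mem_slitPlane h)

/-- **Derivative of `arg ∘ w`** in the slit plane: `Im(w'/w) = (v'u − u'v)/(u² + v²)`.
[folklore] -/
theorem hasDerivAt_arg_loop {u v : ℝ → ℝ} {u' v' x : ℝ} (hu : HasDerivAt u u' x)
    (hv : HasDerivAt v v' x) (h : 0 < u x ∨ v x ≠ 0) :
    HasDerivAt (fun y => Complex.arg ((u y : ℂ) + (v y : ℂ) * I))
      ((v' * u x - u' * v x) / (u x ^ 2 + v x ^ 2)) x := by
  have h1 := Complex.imCLM.hasFDerivAt.comp_hasDerivAt x (hasDerivAt_log_loop hu hv h)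
  rw [← im_logDeriv u' v' h]
  refine h1.congr_of_eventuallyEq ?_
  filter_upwards with y
  simp [Complex.log_im]

/-- Derivative of the modulus square `u² + v²`: `2(u'u + v'v)`. [folklore] -/
theorem hasDerivAt_modSq {u v : ℝ → ℝ} {u' v' x : ℝ} (hu : HasDerivAt u u' x)
    (hv : HasDerivAt v v' x) :
    HasDerivAt (fun y => u y ^ 2 + v y ^ 2) (2 * (u' * u x + v' * v x)) x := by
  have h := (hu.pow 2).add (hv.pow 2)
  refine h.congr_deriv ?_
  simp
  ring

/-! ### Nash-ness of the modulus square -/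

/-- The modulus square of a Nash loop is `ℚ`-semialgebraic. [cite: BochnakCosteRoy1998, §2.2] -/
theorem isSemialgebraicFunOn_modSq {a b : ℝ} {u v : ℝ → ℝ}
    (hus : IsSemialgebraicFunOn ℚ {t : Fin 1 → ℝ | t 0 ∈ Ioo a b} (fun t => u (t 0)))
    (hvs : IsSemialgebraicFunOn ℚ {t : Fin 1 → ℝ | t 0 ∈ Ioo a b} (fun t => v (t 0))) :
    IsSemialgebraicFunOn ℚ {t : Fin 1 → ℝ | t 0 ∈ Ioo a b} (fun t => u (t 0) ^ 2 + v (t 0) ^ 2) :=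
  (hus.fun_pow 2).fun_add (hvs.fun_pow 2)

/-- The modulus square of an analytic loop is analytic. [folklore] -/
theorem analyticAt_modSq {u v : ℝ → ℝ} {x : ℝ} (hu : AnalyticAt ℝ u x) (hv : AnalyticAt ℝ v x) :
    AnalyticAt ℝ (fun y => u y ^ 2 + v y ^ 2) x :=
  (hu.pow 2).add (hv.pow 2)

/-- The logarithm of the modulus: `log ‖u + iv‖ = log(u² + v²)/2`. [folklore] -/
theorem log_norm_loop {u v : ℝ} (h : 0 < u ∨ v ≠ 0) :
    Real.log ‖(u : ℂ) + (v : ℂ) * I‖ = Real.log (u ^ 2 + v ^ 2) / 2 := by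
  rw [norm_loop, Real.log_sqrt (modSq_pos h).le]

end KZ.LiouvilleSector

end Literature.NumberTheory.Transcendental
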